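import Mathlib

/-! # Brick `stub_blockLift` — crux `TwoProducts` (stmt-ValiantsHypothesis-5906), line `corner-log-linearization`

BLOCK LIFT (lead c8, stub 8c; pure algebra).  For bivariate polynomials `p_j, q_j` (`j < N`) of total degree `≤ d`
and `K > N·d`, put `Z = x^K y^K`, `F = Σ_j p_j ∏_{i ≠ j} q_i` (the partial-fraction numerator) and
`D = ∏_j (q_j + Z·p_j) − ∏_j q_j`.  Expanding the product to first order in `Z` gives `D = Z·F + Z²·R` for some
polynomial `R`; every support point of `Z²·R` has both coordinates `≥ 2K`, hence weight `≥ 2K(w₀ + w₁)` for every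
integer weight `w` with positive entries, while every support point `(K,K) + c` of `Z·F` (`c ∈ supp F`,
`c₀ + c₁ ≤ N·d < K`) is strictly lighter.  Consequently `e ↦ e + (K,K)` carries a strict `w`-minimiser of `supp F`
to a strict `w`-minimiser of `supp D`. [folklore] -/

set_option linter.dupNamespace false -- single-conjunct summit: `ValiantsHypothesis.ValiantsHypothesis`

namespace Summit.ValiantsHypothesis.ValiantsHypothesis.Theorems.TwoProducts.BlockLift

open scoped BigOperators Classical Pointwise

/-- First-order expansion of `∏_{j ∈ s} (q_j + Z·p_j)` in `Z`: the constant term is `∏ q_j`, the linear term is the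
partial-fraction numerator `Σ_j p_j ∏_{i ∈ s ∖ j} q_i`, and the rest is a multiple of `Z²`. [folklore] -/
theorem prod_add_mul_expand {ι R : Type*} [CommRing R] [DecidableEq ι] (Z : R) (p q : ι → R) (s : Finset ι) :
    ∃ Rm : R, ∏ j ∈ s, (q j + Z * p j) =
      ∏ j ∈ s, q j + Z * (∑ j ∈ s, p j * ∏ i ∈ s.erase j, q i) + Z * Z * Rm := by
  induction s using Finset.induction_on with
  | empty => exact ⟨0, by simp⟩
  | insert a s ha ih =>
    obtain ⟨Rm, hRm⟩ := ih
    refine ⟨q a * Rm + p a * (∑ j ∈ s, p j * ∏ i ∈ s.erase j, q i) + Z * p a * Rm, ?_⟩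
    have hsum : ∑ j ∈ s, p j * ∏ i ∈ (insert a s).erase j, q i =
        q a * ∑ j ∈ s, p j * ∏ i ∈ s.erase j, q i := by
      rw [Finset.mul_sum]
      refine Finset.sum_congr rfl fun j hj => ?_
      rw [Finset.erase_insert_of_ne (ne_of_mem_of_not_mem hj ha).symm,
        Finset.prod_insert fun h => ha (Finset.mem_of_mem_erase h)]
      ring
    rw [Finset.prod_insert ha, Finset.prod_insert ha, Finset.sum_insert ha, Finset.erase_insert ha,
      hsum, hRm]
    ring

/-- The partial-fraction numerator of `N` pairs of polynomials of total degree `≤ d` has total degree `≤ N·d`.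
[folklore] -/
theorem totalDegree_pfNum_le {N d : ℕ} (p q : Fin N → MvPolynomial (Fin 2) ℂ)
    (hp : ∀ j, (p j).totalDegree ≤ d) (hq : ∀ j, (q j).totalDegree ≤ d) :
    (∑ j, p j * ∏ i ∈ Finset.univ.erase j, q i).totalDegree ≤ N * d := by
  refine MvPolynomial.totalDegree_finsetSum_le fun j _ => ?_
  have h1 : (∏ i ∈ Finset.univ.erase j, q i).totalDegree ≤ (N - 1) * d := by
    refine (MvPolynomial.totalDegree_finsetProd _ _).trans ?_
    refine (Finset.sum_le_card_nsmul _ _ d fun i _ => hq i).trans ?_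
    rw [Finset.card_erase_of_mem (Finset.mem_univ j), Finset.card_univ, Fintype.card_fin, smul_eq_mul]
  have hN : 1 ≤ N := j.pos
  calc (p j * ∏ i ∈ Finset.univ.erase j, q i).totalDegree
      ≤ (p j).totalDegree + (∏ i ∈ Finset.univ.erase j, q i).totalDegree := MvPolynomial.totalDegree_mul _ _
    _ ≤ d + (N - 1) * d := add_le_add (hp j) h1
    _ = N * d := by
      obtain ⟨M, rfl⟩ := Nat.exists_eq_add_of_le' hN
      rw [Nat.add_sub_cancel]
      ring

/-- A support point `c` of a bivariate polynomial `φ` satisfies `c₀ + c₁ ≤ totalDegree φ`. [folklore] -/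
theorem apply_add_apply_le_totalDegree {φ : MvPolynomial (Fin 2) ℂ} {c : Fin 2 →₀ ℕ} (hc : c ∈ φ.support) :
    c 0 + c 1 ≤ φ.totalDegree := by
  have h := MvPolynomial.le_totalDegree hc
  rwa [Finsupp.sum_fintype _ _ (fun _ => rfl), Fin.sum_univ_two] at h

/-- STUB 8c — BLOCK LIFT.  With `Z = x^K y^K` (`K > N·d`, all `p_j, q_j` of total degree `≤ d`), the shift
`e ↦ e + (K,K)` carries every strict minimiser (for an integer weight with positive entries) of the support of the
partial-fraction numerator `Σ_j p_j ∏_{i ≠ j} q_i` to a strict minimiser of the support of the two-products instance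
`∏_j (q_j + Z·p_j) − ∏_j q_j`. [folklore] -/
theorem stub_blockLift : ∀ (N d K : ℕ) (p q : Fin N → MvPolynomial (Fin 2) ℂ),
    (∀ j, (p j).totalDegree ≤ d) → (∀ j, (q j).totalDegree ≤ d) → N * d < K →
    ∀ (w : Fin 2 → ℤ), 0 < w 0 → 0 < w 1 → ∀ (e : Fin 2 →₀ ℕ),
    (e ∈ (∑ j, p j * ∏ i ∈ Finset.univ.erase j, q i).support ∧
      ∀ e' ∈ (∑ j, p j * ∏ i ∈ Finset.univ.erase j, q i).support, e' ≠ e →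
        w 0 * (e 0 : ℤ) + w 1 * (e 1 : ℤ) < w 0 * (e' 0 : ℤ) + w 1 * (e' 1 : ℤ)) →
    ((e + (Finsupp.single 0 K + Finsupp.single 1 K)) ∈
        ((∏ j, (q j + MvPolynomial.monomial (Finsupp.single 0 K + Finsupp.single 1 K) 1 * p j)) -
          ∏ j, q j).support ∧
      ∀ e' ∈ ((∏ j, (q j + MvPolynomial.monomial (Finsupp.single 0 K + Finsupp.single 1 K) 1 * p j)) -
          ∏ j, q j).support,
        e' ≠ e + (Finsupp.single 0 K + Finsupp.single 1 K) →
        w 0 * (((e + (Finsupp.single 0 K + Finsupp.single 1 K) : Fin 2 →₀ ℕ) 0 : ℕ) : ℤ) +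
            w 1 * (((e + (Finsupp.single 0 K + Finsupp.single 1 K) : Fin 2 →₀ ℕ) 1 : ℕ) : ℤ) <
          w 0 * (e' 0 : ℤ) + w 1 * (e' 1 : ℤ)) := by
  intro N d K p q hp hq hK w hw0 hw1 e he
  obtain ⟨he, hmin⟩ := he
  -- notation: `kk = (K,K)`, `Z = x^K y^K`, `F` = partial-fraction numerator
  set kk : Fin 2 →₀ ℕ := Finsupp.single 0 K + Finsupp.single 1 K with hkk
  set Z : MvPolynomial (Fin 2) ℂ := MvPolynomial.monomial kk 1 with hZ
  set F : MvPolynomial (Fin 2) ℂ := ∑ j, p j * ∏ i ∈ Finset.univ.erase j, q i with hF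
  -- first-order expansion `D = Z·F + Z²·Rm`
  obtain ⟨Rm, hRm⟩ := prod_add_mul_expand Z p q Finset.univ
  have hD : (∏ j, (q j + Z * p j)) - ∏ j, q j = Z * F + Z * Z * Rm := by
    rw [hRm]
    ring
  rw [hD]
  have hkk0 : kk 0 = K := by simp [hkk]
  have hkk1 : kk 1 = K := by simp [hkk]
  have hZZ : Z * Z = MvPolynomial.monomial (kk + kk) 1 := by
    rw [hZ, MvPolynomial.monomial_mul, one_mul]
  -- (1) the minimiser `e` is light: `wt e < K (w₀ + w₁)`
  have hewt : w 0 * (e 0 : ℤ) + w 1 * (e 1 : ℤ) < w 0 * K + w 1 * K := by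
    have h := apply_add_apply_le_totalDegree he
    have h2 : F.totalDegree ≤ N * d := totalDegree_pfNum_le p q hp hq
    have he0 : ((e 0 : ℕ) : ℤ) < K := by exact_mod_cast (by omega : e 0 < K)
    have he1 : ((e 1 : ℕ) : ℤ) < K := by exact_mod_cast (by omega : e 1 < K)
    have := mul_lt_mul_of_pos_left he0 hw0
    have := mul_lt_mul_of_pos_left he1 hw1
    linarith
  -- (2) support of `Z·F` is `(K,K) + supp F`
  have hZF : ∀ e' ∈ (Z * F).support, ∃ c ∈ F.support, e' = c + kk := by
    intro e' he'
    rw [MvPolynomial.mem_support_iff, hZ, MvPolynomial.coeff_monomial_mul'] at he'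
    split_ifs at he' with hle
    · refine ⟨e' - kk, ?_, (tsub_add_cancel_of_le hle).symm⟩
      rw [MvPolynomial.mem_support_iff]
      simpa using he'
    · exact absurd rfl he'
  have hcoeffZF : ∀ c, MvPolynomial.coeff (c + kk) (Z * F) = MvPolynomial.coeff c F := by
    intro c
    rw [add_comm c kk, hZ, MvPolynomial.coeff_monomial_mul, one_mul]
  -- (3) support of `Z²·Rm` is heavy: weight `≥ 2K (w₀ + w₁)`
  have hE : ∀ e' ∈ (Z * Z * Rm).support,
      w 0 * (2 * K : ℤ) + w 1 * (2 * K : ℤ) ≤ w 0 * (e' 0 : ℤ) + w 1 * (e' 1 : ℤ) := by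
    intro e' he'
    rw [hZZ, MvPolynomial.mem_support_iff, MvPolynomial.coeff_monomial_mul'] at he'
    split_ifs at he' with hle
    · have h0 := hle 0
      have h1 := hle 1
      simp only [Finsupp.add_apply, hkk0, hkk1] at h0 h1
      have h0' : (2 * K : ℤ) ≤ ((e' 0 : ℕ) : ℤ) := by exact_mod_cast (by omega : 2 * K ≤ e' 0)
      have h1' : (2 * K : ℤ) ≤ ((e' 1 : ℕ) : ℤ) := by exact_mod_cast (by omega : 2 * K ≤ e' 1)
      have := mul_le_mul_of_nonneg_left h0' hw0.le
      have := mul_le_mul_of_nonneg_left h1' hw1.le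
      linarith
    · exact absurd rfl he'
  have hekk0 : (((e + kk) 0 : ℕ) : ℤ) = e 0 + K := by simp [Finsupp.add_apply, hkk0]
  have hekk1 : (((e + kk) 1 : ℕ) : ℤ) = e 1 + K := by simp [Finsupp.add_apply, hkk1]
  -- `e + kk` is too light to lie in the support of the heavy part
  have hnot : e + kk ∉ (Z * Z * Rm).support := by
    intro h
    have := hE _ h
    rw [hekk0, hekk1] at this
    linarith
  refine ⟨?_, ?_⟩
  · rw [MvPolynomial.mem_support_iff, MvPolynomial.coeff_add, hcoeffZF,
      MvPolynomial.notMem_support_iff.mp hnot, add_zero]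
    exact MvPolynomial.mem_support_iff.mp he
  · intro e' he' hne
    rw [hekk0, hekk1]
    rcases Finset.mem_union.mp (MvPolynomial.support_add he') with h | h
    · obtain ⟨c, hc, rfl⟩ := hZF e' h
      have hce : c ≠ e := fun h => hne (by rw [h])
      have hlt := hmin c hc hce
      have hc0 : (((c + kk) 0 : ℕ) : ℤ) = c 0 + K := by simp [Finsupp.add_apply, hkk0]
      have hc1 : (((c + kk) 1 : ℕ) : ℤ) = c 1 + K := by simp [Finsupp.add_apply, hkk1]
      rw [hc0, hc1]
      linarith
    · have := hE e' h
      linarith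

end Summit.ValiantsHypothesis.ValiantsHypothesis.Theorems.TwoProducts.BlockLift
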